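import Summits.ResolutionOfSingularities.ResolutionOfSingularities.Theorems.HomologicalConductorNoZenoRDescentLocal
import Summits.ResolutionOfSingularities.ResolutionOfSingularities.Theorems.HomologicalConductorNoZenoRSteinRestrict
import HarnessLib

/-!
# Crux `NoZenoR` (stmt-ResolutionOfSingularities-19943) — DESCENT of a morphism along a contraction between
# desingularizations (section-free rigidity / universal property of a blow-down)

Route `ResolutionOfSingularities/HomologicalConductor` (cell decomp-res, hand leafhand-res-homologicalconduct-18 g1).
OURS: AI-written proof over tree theorems, weaker than expert review; nothing here is a statement of the manuscript
under review (Hironaka 2017).  SUPPORT level, counted 0.  Def-free, no new named facts.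

**`exists_desc_of_contracts`** — `S` a Noetherian domain, `σ : W₁ → Spec S` and `τ ≫ σ : W′ → Spec S` desingularizations
(so `τ : W′ → W₁` is a proper `S`-morphism of regular surfaces, e.g. a point blow-up), `x′ ∈ W₁` a closed point off
which `τ` is an isomorphism (`IsIso (τ ∣_ {x′}ᶜ)`), and `q : W′ → X` ANY morphism of schemes constant on the fibre
`τ⁻¹(x′)`.  Then `q` descends: `q = τ ≫ q₁` for some `q₁ : W₁ → X`.  Proof: the local descent around `x′`
(`exists_local_fac_of_stein`, with the Stein property `isIso_appTop_morphismRestrict`) and `τ⁻¹ ≫ q` off `x′` agree on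
the overlap (test morphisms into the overlap lift uniquely to `W′` through the isomorphism `τ ∣_ {x′}ᶜ`), so they glue
(Mathlib `Scheme.Cover.glueMorphisms` on the two-piece open cover).  This is the «`W₁` dominates `X`» step of Lipman's
proof of (27.3) (p. 278), i.e. the universal property of the contraction `τ` for morphisms constant on its fibre.

No crux or summit statement is proved here.
-/

noncomputable section

-- single-problem summit: the doubled namespace component `ResolutionOfSingularities` is forced
set_option linter.dupNamespace false

open CategoryTheory CategoryTheory.Limits AlgebraicGeometry TopologicalSpace Topology
open Literature.AlgebraicGeometry.Resolution

universe u

namespace Summit.ResolutionOfSingularities.ResolutionOfSingularities.Theorems.NoZeno.FirstKind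

/-- **Descent along a contraction between desingularizations.**  `S` a Noetherian domain, `σ : W₁ → Spec S` and
`τ ≫ σ` desingularizations, `x′ ∈ W₁` closed with `τ` an isomorphism off `x′`, `q : W′ → X` constant on `τ⁻¹(x′)`
⇒ `∃ q₁ : W₁ → X, τ ≫ q₁ = q`. [cite: Lipman1969, Corollary (27.3), proof (p. 278)];
[cite: MumfordFogartyKirwan1994, Ch. 6 §1 Proposition 6.1 (pp. 115–116)] -/
theorem exists_desc_of_contracts {S : Type u} [CommRing S] [IsNoetherianRing S] [IsDomain S]
    {W' W₁ X : Scheme.{u}} {σ : W₁ ⟶ Spec (.of S)} {τ : W' ⟶ W₁} (hσ : IsResolution σ)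
    (hτσ : IsResolution (τ ≫ σ)) (q : W' ⟶ X) {x' : W₁} (hx' : IsClosed ({x'} : Set W₁))
    [IsIso (τ ∣_ (⟨{x'}ᶜ, hx'.isOpen_compl⟩ : W₁.Opens))] {x₀ : X}
    (hcontr : ∀ w : W', τ.base w = x' → q.base w = x₀) :
    ∃ q₁ : W₁ ⟶ X, τ ≫ q₁ = q := by
  haveI : IsProper σ := hσ.isProper
  haveI : IsProper (τ ≫ σ) := hτσ.isProper
  haveI : IsProper τ := IsProper.of_comp τ σ
  -- the local descent around `x'`
  obtain ⟨U, hU, hxU, g, hg⟩ := exists_local_fac_of_stein τ q hcontr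
    (fun U hU _ => isIso_appTop_morphismRestrict hτσ hσ hU)
  -- the descent off `x'`
  set U₂ : W₁.Opens := ⟨{x'}ᶜ, hx'.isOpen_compl⟩ with hU₂
  let g₂ : (U₂ : Scheme.{u}) ⟶ X := inv (τ ∣_ U₂) ≫ (τ ⁻¹ᵁ U₂).ι ≫ q
  have hg₂ : (τ ∣_ U₂) ≫ g₂ = (τ ⁻¹ᵁ U₂).ι ≫ q := by
    simp only [g₂, IsIso.hom_inv_id_assoc]
  -- the two descents agree on the overlap
  have hcompat : ∀ {P : Scheme.{u}} (a : P ⟶ (U : Scheme.{u})) (b : P ⟶ (U₂ : Scheme.{u})),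
      a ≫ U.ι = b ≫ U₂.ι → a ≫ g = b ≫ g₂ := by
    intro P a b hab
    let ℓ : P ⟶ (τ ⁻¹ᵁ U₂ : Scheme.{u}) := b ≫ inv (τ ∣_ U₂)
    let w : P ⟶ W' := ℓ ≫ (τ ⁻¹ᵁ U₂).ι
    have hℓ : ℓ ≫ (τ ∣_ U₂) = b := by simp only [ℓ, Category.assoc, IsIso.inv_hom_id, Category.comp_id]
    have hw : w ≫ τ = b ≫ U₂.ι := by
      simp only [w, Category.assoc]
      rw [← morphismRestrict_ι, ← Category.assoc, hℓ]
    have hrange : Set.range w.base ⊆ Set.range (τ ⁻¹ᵁ U).ι.base := by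
      rw [Scheme.Opens.range_ι]
      rintro _ ⟨p, rfl⟩
      show τ.base (w.base p) ∈ U
      rw [← Scheme.Hom.comp_apply, hw, ← hab, Scheme.Hom.comp_apply]
      exact (a.base p).2
    let ℓ₁ : P ⟶ (τ ⁻¹ᵁ U : Scheme.{u}) := IsOpenImmersion.lift (τ ⁻¹ᵁ U).ι w hrange
    have hℓ₁ : ℓ₁ ≫ (τ ⁻¹ᵁ U).ι = w := IsOpenImmersion.lift_fac _ _ _
    have ha : a = ℓ₁ ≫ (τ ∣_ U) := by
      rw [← cancel_mono U.ι, Category.assoc, morphismRestrict_ι, ← Category.assoc, hℓ₁, hw, hab]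
    have hb : b = ℓ ≫ (τ ∣_ U₂) := hℓ.symm
    rw [ha, hb, Category.assoc, hg, Category.assoc, hg₂, ← Category.assoc, hℓ₁]
    simp only [w, Category.assoc]
  -- glue
  have hcov : U ⊔ U₂ = ⊤ := by
    apply Opens.ext
    rw [Opens.coe_sup, Opens.coe_top, Set.eq_univ_iff_forall]
    intro w
    by_cases hw : w = x'
    · exact Or.inl (hw ▸ hxU)
    · exact Or.inr hw
  let 𝒰 : W₁.OpenCover := W₁.openCoverOfIsOpenCover (fun b : Bool => cond b U U₂)
    (TopologicalSpace.IsOpenCover.mk (by rw [iSup_bool_eq]; exact hcov))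
  let f : ∀ b : Bool, 𝒰.X b ⟶ X := fun b =>
    match b with
    | true => g
    | false => g₂
  have hf : ∀ x y : Bool, pullback.fst (𝒰.f x) (𝒰.f y) ≫ f x = pullback.snd _ _ ≫ f y := by
    rintro (_ | _) (_ | _)
    · change pullback.fst U₂.ι U₂.ι ≫ g₂ = pullback.snd U₂.ι U₂.ι ≫ g₂
      rw [fst_eq_snd_of_mono_eq]
    · change pullback.fst U₂.ι U.ι ≫ g₂ = pullback.snd U₂.ι U.ι ≫ g
      exact (hcompat _ _ pullback.condition.symm).symm
    · change pullback.fst U.ι U₂.ι ≫ g = pullback.snd U.ι U₂.ι ≫ g₂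
      exact hcompat _ _ pullback.condition
    · change pullback.fst U.ι U.ι ≫ g = pullback.snd U.ι U.ι ≫ g
      rw [fst_eq_snd_of_mono_eq]
  refine ⟨𝒰.glueMorphisms f hf, ?_⟩
  have hU' : U.ι ≫ 𝒰.glueMorphisms f hf = g := 𝒰.ι_glueMorphisms f hf true
  have hU₂' : U₂.ι ≫ 𝒰.glueMorphisms f hf = g₂ := 𝒰.ι_glueMorphisms f hf false
  -- `τ ≫ glue = q`, checked on the open cover `τ⁻¹U`, `τ⁻¹U₂` of `W'`
  refine Scheme.hom_ext_of_forall _ _ fun w => ?_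
  by_cases hw : τ.base w = x'
  · refine ⟨τ ⁻¹ᵁ U, (show τ.base w ∈ U by rw [hw]; exact hxU), ?_⟩
    rw [← Category.assoc, ← morphismRestrict_ι, Category.assoc, hU', hg]
  · refine ⟨τ ⁻¹ᵁ U₂, (show τ.base w ∈ U₂ from hw), ?_⟩
    rw [← Category.assoc, ← morphismRestrict_ι, Category.assoc, hU₂', hg₂]

end Summit.ResolutionOfSingularities.ResolutionOfSingularities.Theorems.NoZeno.FirstKind

end
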